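import Summits.CriticalPhenomena.Ising3DConformalLimit.Theses.MirrorHoelderCompactness
import Summits.CriticalPhenomena.Ising3DConformalLimit.Theses.MonotoneBlocking
import Summits.CriticalPhenomena.Ising3DConformalLimit.Theses.HyperoctahedralRP
import Summits.CriticalPhenomena.Ising3DConformalLimit.Theorems.HyperoctahedralRPHRP2Rigidity
import Summits.CriticalPhenomena.Ising3DConformalLimit.Theorems.HyperoctahedralRPLimitRotationInvariant
import Summits.CriticalPhenomena.Ising3DConformalLimit.Theorems.PerfectScreeningMoebiusLimitExistsTwoLeaf
import Summits.CriticalPhenomena.Ising3DConformalLimit.Theorems.MoebiusLimitExists.Negative.FreeTranslations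
import Literature.Probability.LatticeModels.PointwiseScalingLimitScaleCovariant
import HarnessLib

/-!
# `LimitsAreConformal` (item stmt-CriticalPhenomena-6154) is EXACTLY items 1982 ∧ 0636 — the typed split glue

Crux `MonotoneBlocking.LimitsAreConformal` (shared verbatim with `MirrorHoelderCompactness.LimitsAreConformal`,
`monotoneBlocking_iff_mirror : … := Iff.rfl`): every normalised, non-degenerate, translation-invariant,
scale-covariant (weight `Δ`) pointwise scaling limit `S` of `criticalCorr 3` is (i) `O(3)`-invariant, (ii) inversion
covariant with the same `Δ`, (iii) non-Gaussian (`U₄ ≢ 0`).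

* (i) is a theorem of the tree: `MoebiusLimitExistsTwoLeaf.isRotationInvariant_of_scaleCovariantLimit` =
  `LimitRotationInvariant_of ∘ HRP2Rigidity_of` (items stmt-CriticalPhenomena-1980 / 1979, landed; imported, not restated).
* (ii) under the crux hypotheses is item stmt-CriticalPhenomena-1982 `HyperoctahedralRP.InversionUpgradeNormalised`
  verbatim (Euclidean invariance = translation invariance + (i)).
* (iii) under the crux hypotheses is item stmt-CriticalPhenomena-0636 `HyperoctahedralRP.IsingEuclidUpgradeR4NonGaussian`
  verbatim: that item carries fewer hypotheses (no normalisation / translation invariance / scale covariance), but all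
  three are automatic for a non-degenerate pointwise limit of `criticalCorr 3` — the normalisation `S·𝟙_{NonCoincident}`
  is again a limit with the same `U₄` on non-coincident quadruples (`limitConnectedFour_congr`), it is translation
  invariant (`isTranslationInvariant_normalised_of_limit`) and scale covariant with the automatic dimension of
  `HasPointwiseScalingLimit.exists_rpow_scale`.

Hence the glue `LimitsAreConformal_of_subs : InversionUpgradeNormalised → IsingEuclidUpgradeR4NonGaussian →
LimitsAreConformal`, the two converses, and `LimitsAreConformal_iff_subs` (ZERO SLACK: the crux is the conjunction of the
two hub items of the sub-problem). `LimitsAreConformal_of_subs_expanded` is the same glue with the three ledger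
signatures written out (the stub of that name registered on stmt-CriticalPhenomena-6154), so that the tenure planner's
prepared `ledger route edit route-CriticalPhenomena-MonotoneBlocking --split LimitsAreConformal --into children.json
--glue-by Summit.CriticalPhenomena.Ising3DConformalLimit.Theorems.LimitsAreConformalSplit.LimitsAreConformal_of_subs`
(children = the signatures of stmt-1982 / stmt-0636 byte-for-byte, evidence `children.json` on the item) can be installed.

Provenance: the cut and these proofs are the crux-strategist's (`planner-cstrat-stmt-CriticalPhenomena-6154-b1-0`,
evidence `MonotoneBlockingLimitsAreConformalSplit.lean` and `Cruxes/LimitsAreConformal/Lines/hub_conjuncts.lean`, whose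
§3–§6 this file re-proves against the route decls); landed by the line lead of the crux (PICKED.md: line `hub_conjuncts`).
No new definitions; sorry-free; axioms {propext, Classical.choice, Quot.sound}.
-/

noncomputable section

namespace Summit.CriticalPhenomena.Ising3DConformalLimit.Theorems.LimitsAreConformalSplit

open Literature.Probability.LatticeModels
open Summit.CriticalPhenomena.Ising3DConformalLimit.Theses

/-! ## §1 The two route spellings of the crux are one term -/

/-- The `MonotoneBlocking` and `MirrorHoelderCompactness` spellings of `LimitsAreConformal` are the same term. -/
theorem monotoneBlocking_iff_mirror :
    MonotoneBlocking.LimitsAreConformal ↔ MirrorHoelderCompactness.LimitsAreConformal :=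
  Iff.rfl

/-! ## §2 The glue: items 1982 and 0636 give the crux -/

/-- **GLUE (D-0019 split of `LimitsAreConformal`).** `InversionUpgradeNormalised` (item stmt-CriticalPhenomena-1982) and
`IsingEuclidUpgradeR4NonGaussian` (item stmt-CriticalPhenomena-0636) imply `MonotoneBlocking.LimitsAreConformal`:
(i) is the landed `isRotationInvariant_of_scaleCovariantLimit` (items 1979 + 1980); (ii) is item 1982 fed with Euclidean
invariance `⟨transl, rot⟩`; (iii) is item 0636, which needs only `ρ > 0`, the limit and non-degeneracy. -/
theorem LimitsAreConformal_of_subs :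
    HyperoctahedralRP.InversionUpgradeNormalised → HyperoctahedralRP.IsingEuclidUpgradeR4NonGaussian →
      MonotoneBlocking.LimitsAreConformal := by
  intro hInv hNG ρ Δ S hρ hlim hnorm hnd htr hsc
  have hrot : IsRotationInvariant S :=
    Summit.CriticalPhenomena.Ising3DConformalLimit.MoebiusLimitExistsTwoLeaf.isRotationInvariant_of_scaleCovariantLimit
      hρ hlim hnorm hnd htr hsc
  exact ⟨hrot, hInv ρ Δ S hρ hlim hnorm hnd ⟨htr, hrot⟩ hsc, hNG ρ S hρ hlim hnd⟩

/-- The same glue concluding the `MirrorHoelderCompactness` spelling of the crux (route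
`route-CriticalPhenomena-MirrorHoelderCompactness`, rank 6) by name. -/
theorem LimitsAreConformal_of_subs_mirror :
    HyperoctahedralRP.InversionUpgradeNormalised → HyperoctahedralRP.IsingEuclidUpgradeR4NonGaussian →
      MirrorHoelderCompactness.LimitsAreConformal :=
  LimitsAreConformal_of_subs

/-! ## §3 ZERO SLACK — the converses -/

/-- **LAC ⟹ item 1982** (Euclidean invariance is a stronger hypothesis than translation invariance). -/
theorem inversionUpgradeNormalised_of_limitsAreConformal (h : MonotoneBlocking.LimitsAreConformal) :
    HyperoctahedralRP.InversionUpgradeNormalised := by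
  intro ρ Δ S hρ hlim hnorm hnd heuc hsc
  exact (h ρ Δ S hρ hlim hnorm hnd heuc.1 hsc).2.1

/-- `U₄` of two families that agree on non-coincident pairs and quadruples agree on non-coincident quadruples. -/
theorem limitConnectedFour_congr {S S' : CorrFamily 3}
    (h2 : ∀ z ∈ NonCoincident 3 2, S' 2 z = S 2 z) (h4 : ∀ z ∈ NonCoincident 3 4, S' 4 z = S 4 z)
    {x : Fin 4 → EuclideanSpace ℝ (Fin 3)} (hx : x ∈ NonCoincident 3 4) :
    limitConnectedFour S' x = limitConnectedFour S x := by
  have hinj : Function.Injective x := hx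
  have hvec : ∀ {a b : EuclideanSpace ℝ (Fin 3)}, a ≠ b → Function.Injective ![a, b] := by
    intro a b hab i j hij
    fin_cases i <;> fin_cases j <;> simp_all
  have hp : ∀ i j : Fin 4, i ≠ j → S' 2 ![x i, x j] = S 2 ![x i, x j] :=
    fun i j hij => h2 _ (hvec (hinj.ne hij))
  simp only [limitConnectedFour]
  rw [h4 x hx, hp 0 1 (by decide), hp 2 3 (by decide), hp 0 2 (by decide),
    hp 1 3 (by decide), hp 0 3 (by decide), hp 1 2 (by decide)]

open Classical in
/-- **LAC ⟹ item 0636.** For a non-degenerate pointwise limit `S` of `criticalCorr 3` (any `ρ > 0` on `(0,1]`) the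
normalisation `S' := S·𝟙_{NonCoincident}` is again a limit, normalised, non-degenerate, translation invariant
(`isTranslationInvariant_normalised_of_limit`) and scale covariant with the automatic dimension of
`HasPointwiseScalingLimit.exists_rpow_scale`; the crux gives `HasNontrivialU4 S'`, and `U₄` is read on non-coincident
quadruples only, where `S'` and `S` agree. -/
theorem nonGaussian_of_limitsAreConformal (h : MonotoneBlocking.LimitsAreConformal) :
    HyperoctahedralRP.IsingEuclidUpgradeR4NonGaussian := by
  intro ρ S hρ hlim hnd
  obtain ⟨Δ, -, hcov⟩ := hlim.exists_rpow_scale (by norm_num) hρ hnd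
  set S' : CorrFamily 3 := fun n x => if x ∈ NonCoincident 3 n then S n x else 0 with hS'
  have S'_mem : ∀ {n : ℕ} {z : Fin n → EuclideanSpace ℝ (Fin 3)}, z ∈ NonCoincident 3 n →
      S' n z = S n z := fun hz => by simp only [hS', if_pos hz]
  have S'_nmem : ∀ {n : ℕ} {z : Fin n → EuclideanSpace ℝ (Fin 3)}, z ∉ NonCoincident 3 n →
      S' n z = 0 := fun hz => by simp only [hS', if_neg hz]
  have hlim' : HasPointwiseScalingLimit (criticalCorr 3) ρ S' :=
    fun n => (hlim n).congr_right fun z hz => (S'_mem hz).symm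
  have hnorm' : ∀ n z, z ∉ NonCoincident 3 n → S' n z = 0 := fun n z hz => S'_nmem hz
  have hnd' : IsNondegenerateTwoPoint S' := fun z hz => by rw [S'_mem hz]; exact hnd z hz
  have htr' : IsTranslationInvariant S' :=
    Summit.CriticalPhenomena.Ising3DConformalLimit.MoebiusLimitExistsNegative.isTranslationInvariant_normalised_of_limit
      hlim
  have hsc' : IsScaleCovariant Δ S' := by
    intro n c hc z
    by_cases hz : z ∈ NonCoincident 3 n
    · have hz' : (fun i => c • z i) ∈ NonCoincident 3 n := smul_mem_nonCoincident hc.ne' hz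
      rw [S'_mem hz', S'_mem hz]
      exact hcov n c hc z hz
    · have hz' : (fun i => c • z i) ∉ NonCoincident 3 n := fun h' =>
        hz ((smul_right_injective (EuclideanSpace ℝ (Fin 3)) hc.ne').of_comp_iff z |>.1 h')
      rw [S'_nmem hz', S'_nmem hz, mul_zero]
  obtain ⟨-, -, x, hx, hne⟩ := h ρ Δ S' hρ hlim' hnorm' hnd' htr' hsc'
  refine ⟨x, hx, ?_⟩
  rwa [limitConnectedFour_congr (S := S) (S' := S') (fun z hz => S'_mem hz) (fun z hz => S'_mem hz) hx]
    at hne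

/-- **ZERO SLACK.** The crux `LimitsAreConformal` is EXACTLY the conjunction of the two hub items
`InversionUpgradeNormalised` (stmt-CriticalPhenomena-1982) and `IsingEuclidUpgradeR4NonGaussian`
(stmt-CriticalPhenomena-0636). -/
theorem LimitsAreConformal_iff_subs :
    MonotoneBlocking.LimitsAreConformal ↔
      (HyperoctahedralRP.InversionUpgradeNormalised ∧ HyperoctahedralRP.IsingEuclidUpgradeR4NonGaussian) :=
  ⟨fun h => ⟨inversionUpgradeNormalised_of_limitsAreConformal h, nonGaussian_of_limitsAreConformal h⟩,
    fun h => LimitsAreConformal_of_subs h.1 h.2⟩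

/-! ## §4 The registered glue stub, signatures written out -/

/-- **Registered stub `LimitsAreConformal_of_subs_expanded` of item stmt-CriticalPhenomena-6154** (name + signature as
registered by the crux-strategist, 2026-08-17T09:32:59Z): the glue `LimitsAreConformal_of_subs` with the ledger signatures
of stmt-1982, stmt-0636 and stmt-6154 written out, so a `--supports` landing matches by name and signature. -/
theorem LimitsAreConformal_of_subs_expanded :
    (∀ (ρ : ℝ → ℝ) (Δ : ℝ) (S : Literature.Probability.LatticeModels.CorrFamily 3), (∀ δ ∈ Set.Ioc (0:ℝ) 1, 0 < ρ δ)
      → Literature.Probability.LatticeModels.HasPointwiseScalingLimit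
          (Literature.Probability.LatticeModels.criticalCorr 3) ρ S
      → (∀ n z, z ∉ Literature.Probability.LatticeModels.NonCoincident 3 n → S n z = 0)
      → Literature.Probability.LatticeModels.IsNondegenerateTwoPoint S
      → Literature.Probability.LatticeModels.IsEuclideanInvariant S
      → Literature.Probability.LatticeModels.IsScaleCovariant Δ S
      → Literature.Probability.LatticeModels.IsInversionCovariant Δ S) →
    (∀ (ρ : ℝ → ℝ) (S : Literature.Probability.LatticeModels.CorrFamily 3), (∀ δ ∈ Set.Ioc (0:ℝ) 1, 0 < ρ δ)
      → Literature.Probability.LatticeModels.HasPointwiseScalingLimit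
          (Literature.Probability.LatticeModels.criticalCorr 3) ρ S
      → Literature.Probability.LatticeModels.IsNondegenerateTwoPoint S
      → Literature.Probability.LatticeModels.HasNontrivialU4 S) →
    (∀ (ρ : ℝ → ℝ) (Δ : ℝ) (S : Literature.Probability.LatticeModels.CorrFamily 3), (∀ δ ∈ Set.Ioc (0:ℝ) 1, 0 < ρ δ)
      → Literature.Probability.LatticeModels.HasPointwiseScalingLimit
          (Literature.Probability.LatticeModels.criticalCorr 3) ρ S
      → (∀ n z, z ∉ Literature.Probability.LatticeModels.NonCoincident 3 n → S n z = 0)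
      → Literature.Probability.LatticeModels.IsNondegenerateTwoPoint S
      → Literature.Probability.LatticeModels.IsTranslationInvariant S
      → Literature.Probability.LatticeModels.IsScaleCovariant Δ S
      → Literature.Probability.LatticeModels.IsRotationInvariant S
        ∧ Literature.Probability.LatticeModels.IsInversionCovariant Δ S
        ∧ Literature.Probability.LatticeModels.HasNontrivialU4 S) :=
  LimitsAreConformal_of_subs

end Summit.CriticalPhenomena.Ising3DConformalLimit.Theorems.LimitsAreConformalSplit

end
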